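import Literature.MathematicalPhysics.QuantumFieldTheory.Balaban1983to89.B9Ineq349PConcrete
import Literature.MathematicalPhysics.QuantumFieldTheory.Balaban1983to89.B9Eq376DerivDict
import Literature.MathematicalPhysics.QuantumFieldTheory.Balaban1983to89.B9Ineq368Vprime

/-!
# `Balaban1983to89.B9Thm34GEntries342` — [Balaban1985BackgroundPropagators] Theorem 3.4 p. 400, `G`-clause: ALL FOUR POINTWISE ENTRIES OF (3.42)
# FOR `G(U′U)` — «The extended operators satisfy all the inequalities of Theorems 3.1–3.3 correspondingly» read for Theorem 3.3's entries
# `|G(U)J|, |(∇_U G(U)J)|, |(G(U)∇*_U J)|, |(Δ_U G(U)J)|` of (3.42) p. 397 — for the CONCRETE perturbation `U′ = e^{iηA}` of FILE 15 (every `A`-dependent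
# letter of Sect. B concrete: `V₃(A)`, `P₁(A)`, `P(U)`, `P′(A)`), in the form: EVERY two-sided inverse of the concrete `Δ_a(U′U)` inherits every LEFT
# entry `X·G(U) ≺ B₀P(y)e^{−δd}` of Theorem 3.3 as `X·G(U′U) ≺ B₀c₁(α′)(1 − κ′α₁c₁(α′))⁻¹P(y)e^{−(1−α′)ρd}` ((3.42)₁: `X = 1`, `P = (Lʲη)²`; (3.42)₂: `X = ∇_{U,μ}`,
# `P = Lʲη`; (3.42)₄: `X = Δ_U`, `P = 1`) and every RIGHT entry `G(U)·Y ≺ B₀Lʲη e^{−δd}` as `G(U′U)·Y ≺ B₀Λ_ρ²c₁(α′)(1 − κ′α₁c₁(α′))⁻¹Lʲη e^{−(1−3α′)ρd}`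
# ((3.42)₃: `Y = ∇*_{U,ν}`) — FILE 16 of the Sect. B programme, the companion of FILE 15 `B9Thm34GConcrete.thm34_G_entries13_allConcrete`

statement-level skeleton of published theorems with citation tags; proofs where landed; nothing here is a claim about the Yang–Mills mass gap

CITATION HEADER (lean-in-tree rule).  B9 = T. Bałaban, *Propagators for lattice gauge theories in a background field*, Commun. Math. Phys.
**99** (1985) 389–434 [Balaban1985BackgroundPropagators] (held `paper:balaban1985-cmp99-background-propagators`; journal page = PDF page + 388):
Thm 3.4 p. 400 («There exists a positive constant a₁ such that the operators G′(U), (Q′(U)G′²(U)Q′*(U))⁻¹, R(U), G(U) extend to configurations U′U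
for α₁ ≦ a₁ as analytic functions of A. The extended operators satisfy all the inequalities of Theorems 3.1–3.3 correspondingly.»); Thm 3.3 p. 399
(«Under the assumptions of Theorem 3.1, and with the constants described there, the operator G(U) (a = 1) satisfies the inequalities (3.42)–(3.47), with
G′(U) replaced by G(U) and λ replaced by a function J defined at bonds of the lattice T_η or Ω₀, and with values in g.»); (3.42) p. 397 («|(G′(U)λ)(x)|,
|(∇_U G′(U)λ)(x)|, |(G′(U)∇*_U λ)(x)|, |(Δ_U G′(U)λ)(x)| ≦ B₀[(Lʲη)², Lʲη, Lʲη, 1] e^{−δ₀d(y,y′)}|λ| for x ∈ Δ(y), y ∈ Λ_j, supp λ ⊂ Δ(y′)»); p. 407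
(«hence V(A)G(U) is a small operator in supremum norm, and we have G(U′U) = G(U)(I − V(A)G(U))⁻¹ = Σ_{n=0}^∞ G(U)(V(A)G(U))ⁿ, (3.86) … This way we get
all these inequalities for the operator G(U′U). Thus Theorem 3.4 is proved, assuming that Theorems 3.1–3.3 hold.»); the route pp. 400–407 as in FILE 15.
[4] = [Balaban1984PropagatorsII] Lemma 2.1 p. 234, (2.51)–(2.55) p. 232, (2.66) p. 234; [B11] = [Balaban1985Variational] (135) p. 298.  Cell `lit-balaban`,
seat r06 (B9 fold owner) gen 12, FILE 16; rows B9.Thm3.4 × B9.Thm3.3 × B9.Eq3.85 × B9.Eq3.68 × B9.Eq3.49 × B9.Eq3.76.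

WHAT THIS FILE PROVES (two theorems; 0 `def`; 0 sorry; standard axioms).
* `resolvent_of_inverse` [folklore] — in any ring: `Δ′ = Δ − V`, `ΔG = GΔ = 1`, `Δ′G̃ = G̃Δ′ = 1` ⟹ both resolvent identities of (3.86), `G̃ = G + G̃(VG)` and
  `G̃ = G + GVG̃` (so the Neumann-series operator of (3.86) and ANY two-sided inverse of `Δ_a(U′U)` obey the same fixed-point equations; on the finite
  lattice they coincide).
* **`thm34_G_entries342_allConcrete`** — the hypotheses of FILE 15's `thm34_G_entries13_allConcrete` VERBATIM (minus the single right letter `Ds`/`hGDs`,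
  now universally quantified), plus a two-sided inverse `G̃` of the concrete `Δ_a(U′U) = deltaA (conj b D*D_{U′U}) (conj b Δ′(U′U)) (D_{U′U} ∘ (1 − (P(U) +
  P′(A))) ∘ D*_{U′U}) Q*′ a Q′` (`hinvL`, `hinvR`; P(U) = G′Q′*C⁻¹Q′G′, P′(A) = `pPrime G′ (gPrimeExtEnd G′ (V′G′)) …` with the concrete V′(A) of (3.60)).
  CONCLUSION: (i) for EVERY letter `X` and weight `P ≧ 0` with `X·G(U) ≺ B₀P(y)e^{−δd}`: `X·G̃ ≺ B₀c₁(α′)(1 − κ′α₁c₁(α′))⁻¹P(y)e^{−(1−α′)ρd}`; (ii) for EVERY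
  letter `Y` with `G(U)·Y ≺ B₀Lʲη e^{−δd}`: `G̃·Y ≺ B₀Λ_ρ²c₁(α′)(1 − κ′α₁c₁(α′))⁻¹Lʲη e^{−(1−3α′)ρd}`; `κ′ = kappa385 B₀ (cV385 + Σ_{k∈κ⊕κ}(10 + 8d + (16d +
  12)C₀)M₂Σ‖b_i‖e^{δd₀}) κ₁ κ₂ Λ c₁(β)` EXACTLY FILE 15's constant, `κ₁ = κ₃₇₇(…)` (`hκ₁`), one smallness `κ′α₁c₁(α′) < 1` (`hsmall385`).  With FILE 15
  (existence of such a `G̃`) this is Theorem 3.4's `G`-clause for all four entries of (3.42) (and for every left/right product entry of that shape).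
  PROOF = the printed one, p. 407: (3.84) `Δ_a(U′U) = Δ_a(U) − V(A)` for the concrete letters (`B9Eq386Neumann.eq384_sub` with (3.71) :=
  `B9Eq372RemLetters.conj_lapDDLetter_prodCfg`, (3.76) := `B9Eq376POneLetters.eq376_concrete`, (3.80), (3.82) := `B9Eq382V3Letters.conj_V₃Op_eq_vThree`);
  (3.85) `V(A)G(U) ≺ κ′α₁e^{−ρd}` and its left twin `G(U)V(A) ≺ κ′α₁e^{−ρd}` (`B9Ineq386CommSum.ineq385_op_sum` / `hasMajorant_GV_of_gradForm_comm_sum` fed, as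
  in FILES 8/11/13/15, by the concrete `V₃` letters of `B9Eq382V3Letters`/`B9Eq373CurvComm`, (3.77) for the concrete `P₁` (`B9Ineq377POneConcrete.ineq377_concreteE`)
  from the (3.49) entries of `P(U)` (`B9Ineq349Hom.ineq349_hom`) and the (3.68) entries of `P′(A)` (`B9Ineq368Vprime.ineq368_op{,_D,_Ds,_DDs}_conc` through
  `B9Eq376DerivDict`)); the resolvent identities (3.86) for `G̃` (`resolvent_of_inverse`); then [4] (2.66) in the forms `B9Ineq385VG.gExt_leftEntry_of_386`
  («This way we get all these inequalities for the operator G(U′U)», left entries) and `B9Ineq386RightEntry.gExt_rightEntry_of_386L` (right entries).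

HONEST SCOPE / NOT CLAIMED.  Operator (block `L^∞`) form of [4] (2.51); the Hölder / `L²` / global entries (3.43)–(3.47) for `G(U′U)` are NOT here; the
printed pointwise kernel factors `(L^{j′}η)^{−d}` not used; no kernel ↔ block identification; no analyticity statement (finite-lattice inverses); inputs
left as letters exactly as in FILE 15 (Theorem 3.1 (3.42)₁₋₃ for `G′(U)` per direction, Theorem 3.2 (3.48) and the (3.66)/(3.67) letters, `P₂` with
(3.83)/(3.80), Theorem 3.3's entries for `G(U)` — here the `∇_kG(U)`, `G(U)∇_k` product entries `hDG`/`hGD` and whichever left/right entry the consumer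
feeds —, (3.27) for the concrete `DRD*`, structural block-locality, the explicit threshold polynomials); no row head changes.  Value = the remaining two
pointwise entries (3.42)₂,₄ of Theorem 3.4's `G`-clause for the concrete perturbation, kernel-checked; NOT summit progress.

RELATED IN THE TREE, NOT DUPLICATED (searched 2026-08-22: `lean search 'entries342_allConcrete|resolvent_of_inverse'` = ∅; `B9Ineq385VG.gExt_leftEntry_of_386`
/ `gExt_entry2_of_385_386` are the abstract-letter left entries, USED BY NAME): FILES 8–15 and the gen-7 devices are used BY NAME; nothing restated.
-/

noncomputable section

namespace Literature.MathematicalPhysics.QuantumFieldTheory.Balaban1983to89.B9Thm34GEntries342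

open NormedSpace Complex
open Literature.MathematicalPhysics.QuantumFieldTheory.Balaban1983to89
open Literature.MathematicalPhysics.QuantumFieldTheory.Balaban1983to89.B6RandomWalk (HasMajorant hasMajorant_mono Triangle254 Ineq261)
open Literature.MathematicalPhysics.QuantumFieldTheory.Balaban1983to89.B6RandomWalkHom (HasMajorantHom hasMajorantHom_mono hasMajorantHom_iff)
open Literature.MathematicalPhysics.QuantumFieldTheory.Balaban1983to89.B9Thm34Ext (toB6)
open Literature.MathematicalPhysics.QuantumFieldTheory.Balaban1983to89.B9Ineq347 (ScaleTransfer)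
open Literature.MathematicalPhysics.QuantumFieldTheory.Balaban1983to89.B9Ineq366CPrime (hasMajorant_rate_mono)
open Literature.MathematicalPhysics.QuantumFieldTheory.Balaban1983to89.B9Eq386Neumann (vTotal vThree pTwo deltaA eq384_sub)
open Literature.MathematicalPhysics.QuantumFieldTheory.Balaban1983to89.B9Ineq377POne (kappa377 kappa377_nonneg)
open Literature.MathematicalPhysics.QuantumFieldTheory.Balaban1983to89.B9Ineq385VG (kappa385 kappa385_nonneg gExt_leftEntry_of_386)
open Literature.MathematicalPhysics.QuantumFieldTheory.Balaban1983to89.B9Ineq386RightEntry (gExt_rightEntry_of_386L)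
open Literature.MathematicalPhysics.QuantumFieldTheory.Balaban1983to89.B9Ineq386CommSum (ineq385_op_sum hasMajorant_GV_of_gradForm_comm_sum)
open Literature.MathematicalPhysics.QuantumFieldTheory.Balaban1983to89.B9Eq39Adjoint
open Literature.MathematicalPhysics.QuantumFieldTheory.Balaban1983to89.B9Eq369Small (Through)
open Literature.MathematicalPhysics.QuantumFieldTheory.Balaban1983to89.B9Eq372Locality (stBonds)
open Literature.MathematicalPhysics.QuantumFieldTheory.Balaban1983to89.B9Eq352DivForm (tauF tauB)
open Literature.MathematicalPhysics.QuantumFieldTheory.Balaban1983to89.B9Eq352DivFormLetters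
open Literature.MathematicalPhysics.QuantumFieldTheory.Balaban1983to89.B9Eq352GradLetters (diffLetter)
open Literature.MathematicalPhysics.QuantumFieldTheory.Balaban1983to89.B9Eq371GradLetters (bT bU zeroLetter V1Letter)
open Literature.MathematicalPhysics.QuantumFieldTheory.Balaban1983to89.B9Eq375GradLetters (zeroLetter₂ V1Letter₂)
open Literature.MathematicalPhysics.QuantumFieldTheory.Balaban1983to89.B9Eq372RemLetters
open Literature.MathematicalPhysics.QuantumFieldTheory.Balaban1983to89.B9Eq382V3Letters
open Literature.MathematicalPhysics.QuantumFieldTheory.Balaban1983to89.B9Ineq385V3Concrete (cV385 cV0_nonneg cV385_nonneg)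
open Literature.MathematicalPhysics.QuantumFieldTheory.Balaban1983to89.B9Eq373CurvComm (hasMajorant_comm_V₃_one)
open Literature.MathematicalPhysics.QuantumFieldTheory.Balaban1983to89.B9Ineq386V3Concrete (norm_plaqU_adjacent_of_through)
open Literature.MathematicalPhysics.QuantumFieldTheory.Balaban1983to89.B9Eq376POneLetters
open Literature.MathematicalPhysics.QuantumFieldTheory.Balaban1983to89.B9Ineq377POneConcrete (ineq377_concreteE)
open Literature.MathematicalPhysics.QuantumFieldTheory.Balaban1983to89.B9Ineq349Hom (ineq349_hom)
open Literature.MathematicalPhysics.QuantumFieldTheory.Balaban1983to89.B9Ineq368PPrime (kappa349 kappa368)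
open Literature.MathematicalPhysics.QuantumFieldTheory.Balaban1983to89.B9Ineq368PPrimeDs (kappa368Ds)
open Literature.MathematicalPhysics.QuantumFieldTheory.Balaban1983to89.B9Eq360Vprime (gPrimeExtEnd)
open Literature.MathematicalPhysics.QuantumFieldTheory.Balaban1983to89.B9Eq360VprimeLetters (vPrimeConc cBConc cCConc)
open Literature.MathematicalPhysics.QuantumFieldTheory.Balaban1983to89.B9Ineq363Vprime (cVConc theta363 thetaL363)
open Literature.MathematicalPhysics.QuantumFieldTheory.Balaban1983to89.B9Ineq368Vprime (ineq368_op_conc ineq368_op_D_conc ineq368_op_Ds_conc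
  ineq368_op_DDs_conc)
open Literature.MathematicalPhysics.QuantumFieldTheory.Balaban1983to89.B9Eq376DerivDict (hasMajorantHom_gradLin_comp hasMajorantHom_gradLin
  hasMajorantHom_comp_divLin hasMajorantHom_divLin hasMajorant_gradLin_comp_comp_divLin)

/-! ## §1  (3.84) ⇒ (3.86): any two-sided inverse of `Δ − V` obeys both resolvent identities -/

section Resolvent

variable {R : Type*} [Ring R]

/-- **(3.84)–(3.86), the algebra**: if `Δ′ = Δ − V`, `ΔG = GΔ = 1` ((3.27) for `G = G(U)`) and `G̃` is a two-sided inverse of `Δ′ = Δ_a(U′U)`, then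
`G̃ = G + G̃(VG)` and `G̃ = G + GVG̃` — the fixed-point equations of the Neumann series `G(U′U) = Σ_n G(VG)ⁿ = G(I − VG)⁻¹` of (3.86). [folklore]
[cite: Balaban1985BackgroundPropagators, (3.84)–(3.86) p.407 + (3.27) p.395] -/
theorem resolvent_of_inverse {Δ Δ' V G GExt : R} (h384 : Δ' = Δ - V) (hΔG : Δ * G = 1) (hGΔ : G * Δ = 1)
    (hinvL : Δ' * GExt = 1) (hinvR : GExt * Δ' = 1) : GExt = G + GExt * (V * G) ∧ GExt = G + G * V * GExt := by
  subst h384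
  constructor
  · calc GExt = GExt * (Δ * G) := by rw [hΔG, mul_one]
      _ = GExt * ((Δ - V + V) * G) := by rw [sub_add_cancel]
      _ = GExt * (Δ - V) * G + GExt * (V * G) := by rw [add_mul, mul_add, mul_assoc]
      _ = G + GExt * (V * G) := by rw [hinvR, one_mul]
  · calc GExt = G * Δ * GExt := by rw [hGΔ, one_mul]
      _ = G * ((Δ - V + V) * GExt) := by rw [sub_add_cancel, mul_assoc]
      _ = G * ((Δ - V) * GExt) + G * V * GExt := by rw [add_mul, mul_add, ← mul_assoc G V GExt]
      _ = G + G * V * GExt := by rw [hinvL, mul_one]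

end Resolvent

/-! ## §2  Theorem 3.4, `G`-clause: all four (3.42) entries for every two-sided inverse of the concrete `Δ_a(U′U)` -/

section Assembly

variable {𝔸 : Type*} [NormedRing 𝔸] [NormedAlgebra ℂ 𝔸] [CompleteSpace 𝔸] {ι : Type} [Fintype ι]
variable (b : Module.Basis ι ℝ 𝔸) {S : Type} {κ : Type} [Fintype κ] [LinearOrder κ]
variable (T : κ → Equiv.Perm S) (U : κ → S → 𝔸ˣ)
variable {g : B9.Geometry} [Fintype g.Site] {Rr : ℝ} {H : Prop}
set_option maxHeartbeats 400000 in
/-- **THEOREM 3.4, `G`-CLAUSE — EVERY (3.42)-ENTRY OF THEOREM 3.3 FOR `G(U′U)`, CONCRETE PERTURBATION** («The extended operators satisfy all the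
inequalities of Theorems 3.1–3.3 correspondingly»; p. 407 «This way we get all these inequalities for the operator G(U′U)»).  Hypotheses = FILE 15's
(`B9Thm34GConcrete.thm34_G_entries13_allConcrete`), plus ANY two-sided inverse `G̃` of the concrete `Δ_a(U′U)` (`hinvL`, `hinvR`).  CONCLUSION: (i) every
LEFT entry `X·G(U) ≺ B₀P(y)e^{−δd}` (`P ≧ 0`; (3.42)₁ `X = 1, P = (Lʲη)²`; (3.42)₂ `X = ∇_{U,μ}, P = Lʲη`; (3.42)₄ `X = Δ_U, P = 1`) transfers to `X·G̃ ≺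
B₀c₁(α′)(1 − κ′α₁c₁(α′))⁻¹P(y)e^{−(1−α′)ρd}`; (ii) every RIGHT entry `G(U)·Y ≺ B₀Lʲη e^{−δd}` ((3.42)₃ `Y = ∇*_{U,ν}`) transfers to `G̃·Y ≺ B₀Λ_ρ²c₁(α′)(1 −
κ′α₁c₁(α′))⁻¹Lʲη e^{−(1−3α′)ρd}` — constants and the smallness `κ′α₁c₁(α′) < 1` exactly FILE 15's.
[cite: Balaban1985BackgroundPropagators, Thm 3.4 p.400 + Thm 3.3 p.399 + (3.42) p.397 + (3.82)–(3.86) p.407 + (3.68) p.403 + (3.60)–(3.65) p.402 + (3.25) p.394 + (3.49) p.399 + (3.76)–(3.77) pp.405–406 + (3.37)/(3.35) p.396 + (3.27) p.395; Balaban1984PropagatorsII, Lemma 2.1 p.234 + (2.51)–(2.55) p.232 + (2.66) p.234; Balaban1985Variational, (135) p.298] -/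
theorem thm34_G_entries342_allConcrete [Fintype S] [DecidableEq S] [DecidableEq ι] [DecidableEq g.Site] (blk : S → g.Site) (d : ℕ)
    (δ₀ δ δP δG α β ρ α' ρ₁ α'' Λ Λρ Λρ₁ B₀ κQ BG B₁ Bc' κC cF Cq a₀ κP κP' κ₁ κ₂ α₁ C₀ d₀ M₂ : ℝ)
    (kQ kF : g.Site → S → 𝔸 →L[ℝ] 𝔸) (sQ sF : S → 𝔸 →L[ℝ] 𝔸) (cfun w : g.Site → ℝ)
    (hB₀ : 0 ≤ B₀) (hκQ : 0 ≤ κQ) (hBG : 0 ≤ BG) (hB₁ : 0 ≤ B₁) (hBc' : 0 ≤ Bc') (hκC : 0 ≤ κC) (hcF : 0 ≤ cF) (hCq : 0 ≤ Cq) (ha₀ : 0 ≤ a₀) (hκP' : 0 ≤ κP') (hκ₂ : 0 ≤ κ₂) (hα₁ : 0 ≤ α₁) (hC₀ : 0 ≤ C₀) (hΛ : 1 ≤ Λ) (hΛρ : 0 ≤ Λρ)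
    (hρ : 0 ≤ ρ) (hα : 0 ≤ α) (hβ : 0 ≤ β) (hδ₀ : 0 ≤ δ₀) (hδ : 0 ≤ δ) (hM₂ : 0 ≤ M₂) (hr : ρ + (α + β) * δ₀ ≤ δ)
    (hrP : δ + 2 * ((α + β) * δ₀) ≤ δP) (hrG : δP + (2 * α + β) * δ₀ ≤ δG)
    (hr1 : ρ₁ + (α + β) * δ₀ ≤ δG) (hα''1 : α'' ≤ 1) (hα''0 : 0 ≤ α'') (hρ₁ : 0 ≤ ρ₁) (hα''ρ : 0 ≤ (1 - α'') * ρ₁)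
    (hα''ρ2 : 0 ≤ (1 - 2 * α'') * ρ₁) (hα''ρ3 : 0 ≤ (1 - 3 * α'') * ρ₁) (hΛρ₁ : 0 ≤ Λρ₁)
    (hr368 : δP + 2 * ((2 * α + β) * δ₀) ≤ B9Ineq368Vprime.rateC α'' ρ₁)
    (hκP : κP = kappa349 κQ ((1 + Fintype.card κ) * BG) B₁ Λ (B6.c1 d δ₀ β)) (hα' : α' ≤ 1) (hα'ρ0 : 0 ≤ α' * ρ) (hα'ρ2 : 0 ≤ (1 - 2 * α') * ρ)
    (hκ₁ : κ₁ = kappa377 (4 * (1 + Fintype.card κ) * (M₂ * ∑ i, ‖b i‖) * Real.exp (δP * d₀)) κP κP' Λ (B6.c1 d δ₀ β) α₁)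
    (hdnn : ∀ a a' : g.Site, 0 ≤ g.dist a a') (htri : Triangle254 (toB6 g Rr H)) (hrefl : ∀ y : g.Site, g.dist y y = 0)
    (hsym : ∀ y y' : g.Site, g.dist y y' = g.dist y' y) (hlen : ∀ y : g.Site, 0 < g.len y)
    (h261 : Ineq261 d (toB6 g Rr H) δ₀ β) (h261' : Ineq261 d (toB6 g Rr H) ρ α') (h261'' : Ineq261 d (toB6 g Rr H) ρ₁ α'')
    (hT1 : ScaleTransfer g δ₀ α Λ (fun a => g.len a)) (hT2 : ScaleTransfer g δ₀ α Λ (fun a => g.len a ^ 2))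
    (hT1i : ScaleTransfer g δ₀ α Λ (fun a => (g.len a)⁻¹)) (hT2i : ScaleTransfer g δ₀ α Λ (fun a => (g.len a ^ 2)⁻¹))
    (hT4 : ScaleTransfer g δ₀ α Λ (fun a => (g.len a ^ 4)⁻¹))
    (hTρ : ScaleTransfer g ρ α' Λρ (fun a => g.len a))
    (hTρ₁ : ScaleTransfer g ρ₁ α'' Λρ₁ (fun a => g.len a))
    (hsmall385 : kappa385 B₀
        (cV385 (Fintype.card κ) α₁ C₀ (M₂ * (∑ i, ‖b i‖) * Real.exp (δ * d₀))
          + ∑ _k ∈ (Finset.univ : Finset (κ ⊕ κ)),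
            (10 + 8 * Fintype.card κ + (16 * Fintype.card κ + 12) * C₀) * (M₂ * (∑ i, ‖b i‖) * Real.exp (δ * d₀)))
        κ₁ κ₂ Λ (B6.c1 d δ₀ β) * α₁ * B6.c1 d ρ α' < 1)
    (hrepr : ∀ (v : 𝔸) (i : ι), |b.repr v i| ≤ M₂ * ‖v‖) (hη : 0 < g.eta) (hL : 1 ≤ g.L) (A : κ → S → 𝔸)
    (hT : ∀ (μ ν : κ) (x : S), T μ (T ν x) = T ν (T μ x))
    (hsmall : ∀ y : g.Site, g.eta * (α₁ * (g.len y)⁻¹) ≤ 1 / 4)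
    (hU1 : ∀ m z, ‖((U m z : 𝔸ˣ) : 𝔸)‖ ≤ 1 ∧ ‖(((U m z)⁻¹ : 𝔸ˣ) : 𝔸)‖ ≤ 1)
    -- (3.37) for the exponent field, blockwise, in the shapes files 1–10 read it
    (h337B : ∀ ν k x, ‖((g.eta : ℂ)⁻¹) • covDstar T U ν (A k) x‖ ≤ α₁ * (g.len (blk x) ^ 2)⁻¹)
    (h337F : ∀ μ ν x, ‖((g.eta : ℂ)⁻¹) • covD T U μ (A ν) x‖ ≤ α₁ * (g.len (blk x) ^ 2)⁻¹)
    (h337B' : ∀ μ ν x, ‖((g.eta : ℂ)⁻¹) • covDstar T U ν (A ν) (T μ x)‖ ≤ α₁ * (g.len (blk x) ^ 2)⁻¹)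
    (h337Bτ : ∀ μ x, ‖((g.eta : ℂ)⁻¹) • covDstar T U μ (tauB T U μ (A μ)) x‖ ≤ α₁ * (g.len (blk x) ^ 2)⁻¹)
    (h337FB : ∀ μ ν k x, ‖((g.eta : ℂ)⁻¹) • covD T U μ (A k) ((T ν).symm x)‖ ≤ α₁ * (g.len (blk x) ^ 2)⁻¹)
    (hA : ∀ k x, ‖A k x‖ ≤ α₁ * (g.len (blk x))⁻¹) (hAτB : ∀ ν k x, ‖tauB T U ν (A k) x‖ ≤ α₁ * (g.len (blk x))⁻¹)
    (hAτF : ∀ μ k x, ‖tauF T U μ (A k) x‖ ≤ α₁ * (g.len (blk x))⁻¹)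
    (hAFB : ∀ k μ ν x, ‖A k ((T ν).symm (T μ x))‖ ≤ α₁ * (g.len (blk x))⁻¹)
    (hAst : ∀ μ x m z, (m, z) ∈ stBonds T μ x → ‖A m z‖ ≤ α₁ * (g.len (blk x))⁻¹)
    (hAloc : ∀ μ x m z, (m, z) ∈ B9Eq375Locality.locBondsA T μ x → ‖A m z‖ ≤ α₁ * (g.len (blk x))⁻¹)
    (hdAst : ∀ μ x m n y, Through T μ x m n y →
      ‖covD T U m (A n) y‖ ≤ g.eta * (α₁ * ((g.len (blk x))⁻¹) ^ 2) ∧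
        ‖covD T U n (A m) y‖ ≤ g.eta * (α₁ * ((g.len (blk x))⁻¹) ^ 2))
    -- (3.35) on the plaquettes through each bond, at that bond's block scale
    (h35 : ∀ μ x m n y, Through T μ x m n y → ‖(plaqU T U m n y : 𝔸) - 1‖ ≤ C₀ * ((g.L ^ g.scale (blk x))⁻¹) ^ 2)
    -- stencil geometry
    (hd₀B : ∀ μ x, g.dist (blk x) (blk ((T μ).symm x)) ≤ d₀) (hd₀F : ∀ μ x, g.dist (blk x) (blk (T μ x)) ≤ d₀)
    (hd₀FB : ∀ μ ν x, g.dist (blk x) (blk ((T ν).symm (T μ x))) ≤ d₀)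
    (hd₀st : ∀ μ x (q : κ × S), q ∈ stBonds T μ x → g.dist (blk x) (blk q.2) ≤ d₀)
    (hd₀loc : ∀ μ x (q : κ × S), q ∈ B9Eq375Locality.locBondsA' T μ x → g.dist (blk x) (blk q.2) ≤ d₀)
    (hd₀0 : ∀ y : g.Site, g.dist y y ≤ d₀)
    -- the letters of `P(U) = G′Q′*(Q′G′²Q′*)⁻¹Q′G′` ((3.25)) and of `P′(A)` ((3.57), (3.65), (3.67)) ON THE SITE CARRIER `S × ι`,
    -- Theorem 3.1 (3.42)₁,₂,₃ for `G′(U)` with the DIRECTIONAL derivative letters (p. 398: the choice `∇`/`∇*` is conventional),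
    -- Theorem 3.2 (3.48) for `C⁻¹(U) = (Q′G′²Q′*)⁻¹` and for `C⁻¹(U′U)`, (3.66) for `C′(A)` in resolvent form (3.67), `Q′`/`Q′*` ((3.19)) and
    -- `F′₂`/`F′₂*` ((3.59)) block-local — all at the rate `δ_G`
    {Gp Qp Qps Qp' Qps' Fp₂ Fp₂s Cinv Cinv' Cp : Module.End ℝ (S × ι → ℝ)}
    (h342_1 : HasMajorant (g := toB6 g Rr H) (fun p : S × ι => blk p.1) Gp
      (fun a a' => BG * g.len a ^ 2 * Real.exp (-(δG * g.dist a a'))))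
    (h342_2 : ∀ k : κ ⊕ κ, HasMajorant (g := toB6 g Rr H) (fun p : S × ι => blk p.1)
      (conj b (diffLetter T U ((g.eta : ℂ)⁻¹) k) * Gp) (fun a a' => BG * g.len a * Real.exp (-(δG * g.dist a a'))))
    (h342_3 : ∀ k : κ ⊕ κ, HasMajorant (g := toB6 g Rr H) (fun p : S × ι => blk p.1)
      (Gp * conj b (diffLetter T U ((g.eta : ℂ)⁻¹) k)) (fun a a' => BG * g.len a * Real.exp (-(δG * g.dist a a'))))
    (h357p : Qp' = Qp + Fp₂) (h357ps : Qps' = Qps + Fp₂s) (hCC : Cinv' - Cinv = -(Cinv' * Cp * Cinv))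
    (hQp : HasMajorant (g := toB6 g Rr H) (fun p : S × ι => blk p.1) Qp (fun a a' : g.Site => if a = a' then κQ else 0))
    (hQps : HasMajorant (g := toB6 g Rr H) (fun p : S × ι => blk p.1) Qps (fun a a' : g.Site => if a = a' then κQ else 0))
    (hFp : HasMajorant (g := toB6 g Rr H) (fun p : S × ι => blk p.1) Fp₂ (fun a a' : g.Site => if a = a' then cF * α₁ else 0))
    (hFps : HasMajorant (g := toB6 g Rr H) (fun p : S × ι => blk p.1) Fp₂s (fun a a' : g.Site => if a = a' then cF * α₁ else 0))
    (hCinv : HasMajorant (g := toB6 g Rr H) (fun p : S × ι => blk p.1) Cinv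
      (fun a a' => B₁ * (g.len a ^ 4)⁻¹ * Real.exp (-(δG * g.dist a a'))))
    (hCinv' : HasMajorant (g := toB6 g Rr H) (fun p : S × ι => blk p.1) Cinv'
      (fun a a' => Bc' * (g.len a ^ 4)⁻¹ * Real.exp (-(δG * g.dist a a'))))
    (hCp : HasMajorant (g := toB6 g Rr H) (fun p : S × ι => blk p.1) Cp
      (fun a a' => κC * α₁ * g.len a ^ 4 * Real.exp (-(δG * g.dist a a'))))
    -- the data of the CONCRETE `V′(A)` of (3.60) (`B9Eq360VprimeLetters.vPrimeConc`): averaging kernels and their sizes ((3.19), (3.59)), the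
    -- `a`-weights ((3.24)), and the two smallness conditions of `B9Ineq363Vprime` («for α₁ sufficiently small», p. 402)
    (hw : ∀ y, 0 ≤ w y) (hcard : ∀ y, ((B9Eq360Vprime.block blk y).card : ℝ) * w y ≤ 1)
    (hkQ : ∀ y x, blk x = y → ‖kQ y x‖ ≤ w y) (hkF : ∀ y x, blk x = y → ‖kF y x‖ ≤ Cq * α₁ * w y)
    (hsQ : ∀ x, ‖sQ x‖ ≤ 1) (hsF : ∀ x, ‖sF x‖ ≤ Cq * α₁) (hcfun : ∀ y, |cfun y| ≤ a₀ * (g.len y ^ 2)⁻¹)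
    (hθ : theta363 (Fintype.card κ) 1 α₁ a₀ Cq M₂ (∑ i, ‖b i‖) (Real.exp (δG * d₀)) BG Λ (B6.c1 d δ₀ β) *
      B6.c1 d ρ₁ α'' < 1)
    (hθL : thetaL363 (Fintype.card κ) 1 α₁ a₀ Cq M₂ (∑ i, ‖b i‖) (Real.exp (δG * d₀)) BG Λ (B6.c1 d δ₀ β) *
      B6.c1 d ρ₁ α'' < 1)
    -- the constant `κ_{P′}` of the (3.77)-step dominates the four explicit (3.68)-constants of `B9Ineq368Vprime`
    (hK1 : kappa368 κQ cF
        (kappa385 1 (cVConc (Fintype.card κ) 1 α₁ a₀ Cq M₂ (∑ i, ‖b i‖) (Real.exp (δG * d₀))) 0 0 Λ (B6.c1 d δ₀ β))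
        κC BG BG (BG * B6.c1 d ρ₁ α'' *
          (1 - theta363 (Fintype.card κ) 1 α₁ a₀ Cq M₂ (∑ i, ‖b i‖) (Real.exp (δG * d₀)) BG Λ (B6.c1 d δ₀ β) * B6.c1 d ρ₁ α'')⁻¹)
        B₁ Bc' Λ (B6.c1 d δ₀ β) α₁ ≤ κP')
    (hK3 : Fintype.card κ * kappa368Ds κQ cF
        (kappa385 BG (cVConc (Fintype.card κ) 1 α₁ a₀ Cq M₂ (∑ i, ‖b i‖) (Real.exp (δG * d₀))) 0 0 Λ (B6.c1 d δ₀ β))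
        κC BG BG BG (B6.c1 d ρ₁ α'' *
          (1 - theta363 (Fintype.card κ) 1 α₁ a₀ Cq M₂ (∑ i, ‖b i‖) (Real.exp (δG * d₀)) BG Λ (B6.c1 d δ₀ β) * B6.c1 d ρ₁ α'')⁻¹)
        (BG * Λρ₁ ^ 2 * B6.c1 d ρ₁ α'' *
          (1 - thetaL363 (Fintype.card κ) 1 α₁ a₀ Cq M₂ (∑ i, ‖b i‖) (Real.exp (δG * d₀)) BG Λ (B6.c1 d δ₀ β) * B6.c1 d ρ₁ α'')⁻¹)
        B₁ Bc' (cBConc (Fintype.card κ) M₂ (∑ i, ‖b i‖) (Real.exp (B9Ineq368Vprime.rateC α'' ρ₁ * d₀)))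
        (cCConc (Fintype.card κ) 1 α₁ a₀ Cq M₂ (∑ i, ‖b i‖) (Real.exp (B9Ineq368Vprime.rateC α'' ρ₁ * d₀))) Λ (B6.c1 d δ₀ β) α₁
        ≤ κP')
    -- the abstract data of (3.80), the inverse property for the concrete `DRD*` and Theorem 3.3 for G(U)
    {G P₂ Qs Qs' Q Q' a F₂ F₂s : Module.End ℝ ((κ × S) × ι → ℝ)}
    (h380 : Q' = Q + F₂) (h380s : Qs' = Qs + F₂s) (hP₂def : P₂ = pTwo Qs Q F₂ F₂s a)
    (hΔG : deltaA (conj b (lapDDLetter T ((g.eta : ℂ)⁻¹) U)) (conj b (dPrimeLetter T U g.eta))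
      (conjHom b (gradLin T ((g.eta : ℂ)⁻¹) U) ∘ₗ (1 - (Gp ∘ₗ Qps ∘ₗ Cinv ∘ₗ Qp ∘ₗ Gp)) ∘ₗ conjHom b (divLin T ((g.eta : ℂ)⁻¹) U)) Qs a Q * G = 1)
    (hGΔ : G * deltaA (conj b (lapDDLetter T ((g.eta : ℂ)⁻¹) U)) (conj b (dPrimeLetter T U g.eta))
      (conjHom b (gradLin T ((g.eta : ℂ)⁻¹) U) ∘ₗ (1 - (Gp ∘ₗ Qps ∘ₗ Cinv ∘ₗ Qp ∘ₗ Gp)) ∘ₗ conjHom b (divLin T ((g.eta : ℂ)⁻¹) U)) Qs a Q = 1)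
    (hP₂ : HasMajorant (g := toB6 g Rr H) (fun q : (κ × S) × ι => blk q.1.2) P₂
      (fun a a' => κ₂ * α₁ * (g.len a ^ 2)⁻¹ * Real.exp (-(δ * g.dist a a'))))
    (hG : HasMajorant (g := toB6 g Rr H) (fun q : (κ × S) × ι => blk q.1.2) G
      (fun a a' => B₀ * g.len a ^ 2 * Real.exp (-(δ * g.dist a a'))))
    (hDG : ∀ k : κ ⊕ κ, HasMajorant (g := toB6 g Rr H) (fun q : (κ × S) × ι => blk q.1.2)
      (conj b (diffLetter (bT T) (bU U) ((g.eta : ℂ)⁻¹) k) * G) (fun a a' => B₀ * g.len a * Real.exp (-(δ * g.dist a a'))))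
    (hGD : ∀ k : κ ⊕ κ, HasMajorant (g := toB6 g Rr H) (fun q : (κ × S) × ι => blk q.1.2)
      (G * conj b (diffLetter (bT T) (bU U) ((g.eta : ℂ)⁻¹) k)) (fun a a' => B₀ * g.len a * Real.exp (-(δ * g.dist a a'))))
    -- ANY two-sided inverse of the concrete `Δ_a(U′U)` (e.g. the one of FILE 15's `thm34_G_entries13_allConcrete`)
    {GExt : Module.End ℝ ((κ × S) × ι → ℝ)}
    (hinvL :
      deltaA (conj b (lapDDLetter T ((g.eta : ℂ)⁻¹) (prodCfg U g.eta A)))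
          (conj b (dPrimeLetter T (prodCfg U g.eta A) g.eta))
          (conjHom b (gradLin T ((g.eta : ℂ)⁻¹) (prodCfg U g.eta A)) ∘ₗ (1 - ((Gp ∘ₗ Qps ∘ₗ Cinv ∘ₗ Qp ∘ₗ Gp) + (B9Eq360Vprime.pPrime Gp (gPrimeExtEnd Gp (conj b (vPrimeConc T U g.eta A blk kQ kF sQ sF cfun) * Gp)) Qps Qps' Cinv Cinv' Qp Qp')))
            ∘ₗ conjHom b (divLin T ((g.eta : ℂ)⁻¹) (prodCfg U g.eta A))) Qs' a Q' * GExt = 1)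
    (hinvR : GExt *
      deltaA (conj b (lapDDLetter T ((g.eta : ℂ)⁻¹) (prodCfg U g.eta A)))
          (conj b (dPrimeLetter T (prodCfg U g.eta A) g.eta))
          (conjHom b (gradLin T ((g.eta : ℂ)⁻¹) (prodCfg U g.eta A)) ∘ₗ (1 - ((Gp ∘ₗ Qps ∘ₗ Cinv ∘ₗ Qp ∘ₗ Gp) + (B9Eq360Vprime.pPrime Gp (gPrimeExtEnd Gp (conj b (vPrimeConc T U g.eta A blk kQ kF sQ sF cfun) * Gp)) Qps Qps' Cinv Cinv' Qp Qp')))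
            ∘ₗ conjHom b (divLin T ((g.eta : ℂ)⁻¹) (prodCfg U g.eta A))) Qs' a Q' = 1) :
    (∀ (X : Module.End ℝ ((κ × S) × ι → ℝ)) (P : g.Site → ℝ), (∀ y, 0 ≤ P y) →
      HasMajorant (g := toB6 g Rr H) (fun q : (κ × S) × ι => blk q.1.2) (X * G)
        (fun a a' => B₀ * P a * Real.exp (-(δ * g.dist a a'))) →
      HasMajorant (g := toB6 g Rr H) (fun q : (κ × S) × ι => blk q.1.2) (X * GExt)
        (fun a a' => B₀ * B6.c1 d ρ α' *
          (1 - kappa385 B₀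
            (cV385 (Fintype.card κ) α₁ C₀ (M₂ * (∑ i, ‖b i‖) * Real.exp (δ * d₀))
              + ∑ _k ∈ (Finset.univ : Finset (κ ⊕ κ)),
                (10 + 8 * Fintype.card κ + (16 * Fintype.card κ + 12) * C₀) * (M₂ * (∑ i, ‖b i‖) * Real.exp (δ * d₀)))
            κ₁ κ₂ Λ (B6.c1 d δ₀ β) * α₁ * B6.c1 d ρ α')⁻¹ *
          P a * Real.exp (-((1 - α') * ρ * g.dist a a')))) ∧
    (∀ Y : Module.End ℝ ((κ × S) × ι → ℝ),
      HasMajorant (g := toB6 g Rr H) (fun q : (κ × S) × ι => blk q.1.2) (G * Y)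
        (fun a a' => B₀ * g.len a * Real.exp (-(δ * g.dist a a'))) →
      HasMajorant (g := toB6 g Rr H) (fun q : (κ × S) × ι => blk q.1.2) (GExt * Y)
        (fun a a' => B₀ * Λρ ^ 2 * B6.c1 d ρ α' *
          (1 - kappa385 B₀
            (cV385 (Fintype.card κ) α₁ C₀ (M₂ * (∑ i, ‖b i‖) * Real.exp (δ * d₀))
              + ∑ _k ∈ (Finset.univ : Finset (κ ⊕ κ)),
                (10 + 8 * Fintype.card κ + (16 * Fintype.card κ + 12) * C₀) * (M₂ * (∑ i, ‖b i‖) * Real.exp (δ * d₀)))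
            κ₁ κ₂ Λ (B6.c1 d δ₀ β) * α₁ * B6.c1 d ρ α')⁻¹ *
          g.len a * Real.exp (-((1 - 3 * α') * ρ * g.dist a a')))) := by
  have hcardκ : (0 : ℝ) ≤ Fintype.card κ := Nat.cast_nonneg _
  have hαβ : 0 ≤ (α + β) * δ₀ := mul_nonneg (add_nonneg hα hβ) hδ₀
  have h2αβ : 0 ≤ (2 * α + β) * δ₀ := mul_nonneg (add_nonneg (mul_nonneg zero_le_two hα) hβ) hδ₀
  have hδP0 : 0 ≤ δP :=
    le_trans (add_nonneg hδ (mul_nonneg zero_le_two hαβ)) hrP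
  have hδG0 : 0 ≤ δG := le_trans (le_trans hδP0 (le_add_of_nonneg_right h2αβ)) hrG
  have hBG' : 0 ≤ (1 + Fintype.card κ) * BG := mul_nonneg (add_nonneg zero_le_one hcardκ) hBG
  have hBGle : BG ≤ (1 + Fintype.card κ) * BG := by
    have h : (1 : ℝ) ≤ 1 + Fintype.card κ := le_add_of_nonneg_right hcardκ
    simpa using mul_le_mul_of_nonneg_right h hBG
  have hκBGle : Fintype.card κ * BG ≤ (1 + Fintype.card κ) * BG :=
    mul_le_mul_of_nonneg_right (le_add_of_nonneg_left zero_le_one) hBG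
  have hr368' : δP + 2 * ((2 * α + β) * δ₀) ≤ (1 - α'') * ρ₁ := by
    have h3 : B9Ineq368Vprime.rateC α'' ρ₁ ≤ (1 - α'') * ρ₁ := by
      have h4 : 0 ≤ 2 * α'' * ρ₁ := mul_nonneg (mul_nonneg zero_le_two hα''0) hρ₁
      unfold B9Ineq368Vprime.rateC
      linarith only [h4]
    exact hr368.trans h3
  -- the shapes `B9Ineq368Vprime` reads (3.37)/(3.35)/stencil geometry in
  have hA' : ∀ μ x, ‖A μ x‖ ≤ α₁ * (g.len (blk x))⁻¹ ∧ ‖tauB T U μ (A μ) x‖ ≤ α₁ * (g.len (blk x))⁻¹ :=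
    fun μ x => ⟨hA μ x, hAτB μ μ x⟩
  have h337s' : ∀ μ x, ‖((g.eta : ℂ)⁻¹) • covDstar T U μ (A μ) x‖ ≤ α₁ * (g.len (blk x) ^ 2)⁻¹ := fun μ x => h337B μ μ x
  have h337F' : ∀ μ x, ‖((g.eta : ℂ)⁻¹) • covD T U μ (A μ) x‖ ≤ α₁ * (g.len (blk x) ^ 2)⁻¹ := fun μ x => h337F μ μ x
  have hd₀' : ∀ μ x, g.dist (blk x) (blk (T μ x)) ≤ d₀ ∧ g.dist (blk x) (blk ((T μ).symm x)) ≤ d₀ :=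
    fun μ x => ⟨hd₀F μ x, hd₀B μ x⟩
  -- Theorem 3.1's entries for `G′(U)` in FILE 13's two-space shapes, common constant `(1 + card κ)B_G` (FILE 14)
  have hw1 : ∀ a : g.Site, 0 ≤ g.len a := fun a => (hlen a).le
  have hGp' : HasMajorant (g := toB6 g Rr H) (fun p : S × ι => blk p.1) Gp
      (fun a a' => (1 + Fintype.card κ) * BG * g.len a ^ 2 * Real.exp (-(δG * g.dist a a'))) :=
    hasMajorant_mono _ h342_1 fun a a' =>
      mul_le_mul_of_nonneg_right (mul_le_mul_of_nonneg_right hBGle (sq_nonneg _)) (Real.exp_nonneg _)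
  have hDGp' : HasMajorantHom (g := toB6 g Rr H) (fun p : S × ι => blk p.1) (fun q : (κ × S) × ι => blk q.1.2)
      (conjHom b (gradLin T ((g.eta : ℂ)⁻¹) U) ∘ₗ Gp) (fun a a' => (1 + Fintype.card κ) * BG * g.len a * Real.exp (-(δG * g.dist a a'))) :=
    hasMajorantHom_mono _ _ (hasMajorantHom_gradLin (R := Rr) (H := H) b T U blk ((g.eta : ℂ)⁻¹) fun μ => h342_2 (Sum.inl μ))
      fun a a' => mul_le_mul_of_nonneg_right (mul_le_mul_of_nonneg_right hBGle (hw1 a)) (Real.exp_nonneg _)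
  have hGpDs' : HasMajorantHom (g := toB6 g Rr H) (fun q : (κ × S) × ι => blk q.1.2) (fun p : S × ι => blk p.1)
      (Gp ∘ₗ conjHom b (divLin T ((g.eta : ℂ)⁻¹) U)) (fun a a' => (1 + Fintype.card κ) * BG * g.len a * Real.exp (-(δG * g.dist a a'))) :=
    hasMajorantHom_mono _ _ (hasMajorantHom_divLin (R := Rr) (H := H) b T U blk ((g.eta : ℂ)⁻¹) fun ν => h342_3 (Sum.inr ν))
      fun a a' => by
        calc (Fintype.card κ : ℝ) * (BG * g.len a * Real.exp (-(δG * g.dist a a')))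
            = Fintype.card κ * BG * g.len a * Real.exp (-(δG * g.dist a a')) := by ring
          _ ≤ (1 + Fintype.card κ) * BG * g.len a * Real.exp (-(δG * g.dist a a')) :=
            mul_le_mul_of_nonneg_right (mul_le_mul_of_nonneg_right hκBGle (hw1 a)) (Real.exp_nonneg _)
  have hQp' : HasMajorantHom (g := toB6 g Rr H) (fun p : S × ι => blk p.1) (fun p : S × ι => blk p.1) Qp
      (fun a a' : g.Site => if a = a' then κQ else 0) := (hasMajorantHom_iff (g := toB6 g Rr H) _ _ _).mpr hQp
  have hQps' : HasMajorantHom (g := toB6 g Rr H) (fun p : S × ι => blk p.1) (fun p : S × ι => blk p.1) Qps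
      (fun a a' : g.Site => if a = a' then κQ else 0) := (hasMajorantHom_iff (g := toB6 g Rr H) _ _ _).mpr hQps
  -- the four (3.68) entries of the CONCRETE `P′(A)` (gen 9/10), at the rate `δ_P`
  have e1 := ineq368_op_conc (Rr := Rr) (H := H) b T U blk d hη A kQ kF sQ sF cfun w 1 d₀ M₂ Cq a₀ δ₀ δG α β ρ₁ α'' δP Λ BG κQ cF κC B₁
    Bc' α₁ hκQ hcF hκC hB₁ hBc' hBG hα₁ hΛ hρ₁ hδP0 hα hβ hδ₀ hδG0 hr1 hα''0 hα''1 hr368' hdnn hrefl htri hlen h261 h261'' hT1 hT2 hT4 hM₂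
    hrepr hsmall hA' h337s' hU1 hd₀' hd₀0 hw hcard hCq ha₀ hkQ hkF hsQ hsF hcfun hθ h342_1 h342_2 h357p h357ps hCC hQp hQps hFp hFps hCinv
    hCinv' hCp
  have e2 : ∀ μ : κ, _ := fun μ =>
    ineq368_op_D_conc (Rr := Rr) (H := H) b T U blk d hη A kQ kF sQ sF cfun w 1 d₀ M₂ Cq a₀ δ₀ δG α β ρ₁ α'' δP Λ BG BG κQ cF κC
      B₁ Bc' α₁ hκQ hcF hκC hB₁ hBc' hBG hBG hα₁ hΛ hρ₁ hδP0 hα hβ hδ₀ hδG0 hr1 hα''0 hα''1 hr368' hdnn hrefl htri hlen h261 h261'' hT1 hT2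
      hT4 hM₂ hrepr hsmall hA' h337s' hU1 hd₀' hd₀0 hw hcard hCq ha₀ hkQ hkF hsQ hsF hcfun hθ (D₀ := conj b (diffLetter T U ((g.eta : ℂ)⁻¹) (Sum.inl μ)))
      (h342L := h342_2 (Sum.inl μ)) h342_1 h342_2 h357p h357ps hCC hQp hQps hFp hFps hCinv hCinv' hCp
  have e3 : ∀ ν : κ, _ := fun ν =>
    ineq368_op_Ds_conc (Rr := Rr) (H := H) b T U blk d hη A kQ kF sQ sF cfun w 1 d₀ M₂ Cq a₀ δ₀ δG α β ρ₁ α'' δP Λ Λρ₁ BG κQ cF κC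
      B₁ Bc' α₁ hκQ hcF hκC hB₁ hBc' hBG hα₁ hΛ hΛρ₁ hρ₁ hδP0 hα hβ hδ₀ hδG0 hr1 hα''1 hα''0 hα''ρ hα''ρ2 hα''ρ3 hr368 hdnn hrefl hsym htri
      hlen h261 h261'' hT1 hT2 hT1i hT2i hT4 hTρ₁ hM₂ hrepr hsmall hA' h337s' h337F' h337Bτ hU1 hd₀' hd₀0 hw hcard hCq ha₀ hkQ hkF hsQ hsF
      hcfun hθ hθL (Ds := conj b (diffLetter T U ((g.eta : ℂ)⁻¹) (Sum.inr ν))) h342_1 h342_2 h342_3 (h342R := h342_3 (Sum.inr ν)) h357p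
      h357ps hCC hQp hQps hFp hFps hCinv hCinv' hCp
  have e4 : ∀ μ ν : κ, _ := fun μ ν =>
    ineq368_op_DDs_conc (Rr := Rr) (H := H) b T U blk d hη A kQ kF sQ sF cfun w 1 d₀ M₂ Cq a₀ δ₀ δG α β ρ₁ α'' δP Λ Λρ₁ BG BG κQ cF
      κC B₁ Bc' α₁ hκQ hcF hκC hB₁ hBc' hBG hBG hα₁ hΛ hΛρ₁ hρ₁ hδP0 hα hβ hδ₀ hδG0 hr1 hα''1 hα''0 hα''ρ hα''ρ2 hα''ρ3 hr368 hdnn hrefl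
      hsym htri hlen h261 h261'' hT1 hT2 hT1i hT2i hT4 hTρ₁ hM₂ hrepr hsmall hA' h337s' h337F' h337Bτ hU1 hd₀' hd₀0 hw hcard hCq ha₀ hkQ hkF
      hsQ hsF hcfun hθ hθL (D₀ := conj b (diffLetter T U ((g.eta : ℂ)⁻¹) (Sum.inl μ)))
      (Ds := conj b (diffLetter T U ((g.eta : ℂ)⁻¹) (Sum.inr ν))) h342_1 h342_2 h342_3 (h342R := h342_3 (Sum.inr ν))
      (h342L := h342_2 (Sum.inl μ)) h357p h357ps hCC hQp hQps hFp hFps hCinv hCinv' hCp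
  dsimp only at e1 e2 e3 e4
  -- the four `P′`-entry hypotheses of FILE 13, constants weakened to `κ_{P′}`
  have hPp := hasMajorant_mono (g := toB6 g Rr H) _ e1 fun a a' =>
    mul_le_mul_of_nonneg_right (mul_le_mul_of_nonneg_right hK1 hα₁) (Real.exp_nonneg (-(δP * g.dist a a')))
  have hDPp := hasMajorantHom_gradLin_comp (R := Rr) (H := H) b T U blk ((g.eta : ℂ)⁻¹) fun μ =>
    hasMajorant_mono (g := toB6 g Rr H) _ (e2 μ) fun a a' =>
      mul_le_mul_of_nonneg_right (mul_le_mul_of_nonneg_right (mul_le_mul_of_nonneg_right hK1 hα₁) (inv_nonneg.mpr (hw1 a)))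
        (Real.exp_nonneg (-(δP * g.dist a a')))
  have aux : ∀ K a1 li e : ℝ, (Fintype.card κ : ℝ) * K ≤ κP' → 0 ≤ a1 → 0 ≤ li → 0 ≤ e →
      (Fintype.card κ : ℝ) * (K * a1 * li * e) ≤ κP' * a1 * li * e := by
    intro K a1 li e hK ha1 hli he
    calc (Fintype.card κ : ℝ) * (K * a1 * li * e) = Fintype.card κ * K * a1 * li * e := by ring
      _ ≤ κP' * a1 * li * e := mul_le_mul_of_nonneg_right (mul_le_mul_of_nonneg_right (mul_le_mul_of_nonneg_right hK ha1) hli) he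
  have hPpDs := hasMajorantHom_mono (g := toB6 g Rr H) _ _
    (hasMajorantHom_comp_divLin (R := Rr) (H := H) b T U blk ((g.eta : ℂ)⁻¹) e3) fun a a' =>
      aux _ _ _ _ hK3 hα₁ (inv_nonneg.mpr (hw1 a)) (Real.exp_nonneg (-(δP * g.dist a a')))
  have hDPpDs := hasMajorant_mono (g := toB6 g Rr H) _
    (hasMajorant_gradLin_comp_comp_divLin (R := Rr) (H := H) b T U blk ((g.eta : ℂ)⁻¹) e4) fun a a' =>
      aux _ _ _ _ hK3 hα₁ (inv_nonneg.mpr (sq_nonneg (g.len a))) (Real.exp_nonneg (-(δP * g.dist a a')))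
  -- FILE 13: the (3.49) entries of `P(U) = G′Q′*(Q′G′²Q′*)⁻¹Q′G′`, every letter between its carriers (FILE 12), at the rate `δ_P`
  have hκP0 : 0 ≤ κP := by
    rw [hκP]; unfold kappa349; positivity
  obtain ⟨hP, hDP, hPDs, -⟩ := ineq349_hom (R := Rr) (H := H) (fun p : S × ι => blk p.1) (fun q : (κ × S) × ι => blk q.1.2)
    (fun p : S × ι => blk p.1) d δ₀ δG α β δP Λ κQ ((1 + Fintype.card κ) * BG) B₁ hκQ hBG' hB₁ hΛ hδP0 hα hβ hδ₀ hrG hdnn htri hlen h261 hT1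
    hT2 hT4 hQp' hQps' hGp' hDGp' hGpDs' hCinv
  rw [← hκP] at hP hDP hPDs
  -- FILE 11: (3.76) with `P₁(A)` concrete (FILE 10) and (3.77) for it, at the rate `δ`
  have hΛ0 : 0 ≤ Λ := zero_le_one.trans hΛ
  have hκ₁0 : 0 ≤ κ₁ := by
    rw [hκ₁]
    exact kappa377_nonneg (by positivity) hκP0 hκP' hΛ0 (B6RandomWalk.c1_nonneg d δ₀ β) hα₁
  have h376 := eq376_concrete T U b hη.ne' A (Gp ∘ₗ Qps ∘ₗ Cinv ∘ₗ Qp ∘ₗ Gp)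
    (B9Eq360Vprime.pPrime Gp (gPrimeExtEnd Gp (conj b (vPrimeConc T U g.eta A blk kQ kF sQ sF cfun) * Gp)) Qps Qps' Cinv Cinv' Qp Qp')
  have hP₁ := ineq377_concreteE (Rr := Rr) (H := H) b T U blk d δ₀ δP α β δ Λ κP κP' α₁ d₀ M₂ hκP0 hκP' hα₁ hΛ hδ hα hβ hδ₀ hδP0 hM₂ hrP
    hdnn htri hlen h261 hT1i hrepr hη hU1 A hA (fun ν x => hAτB ν ν x) hsmall hd₀F hd₀B hP hDP hPDs hPp hDPp hPpDs hDPpDs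
  rw [← hκ₁] at hP₁
  -- FILE 8: the concrete `V₃(A)` letters of (3.82) (gradient form, (3.73) sizes, the commutators) and (3.71)
  set M : ℝ := M₂ * (∑ i, ‖b i‖) * Real.exp (δ * d₀) with hM
  have hbsum : 0 ≤ ∑ i, ‖b i‖ := Finset.sum_nonneg fun i _ => norm_nonneg _
  have hM0 : 0 ≤ M := by positivity
  have hcV0 := cV0_nonneg (Fintype.card κ) hα₁ hC₀
  have hcV := cV385_nonneg (Fintype.card κ) hα₁ hC₀ hM0
  have hcK0 : 0 ≤ (10 + 8 * Fintype.card κ + (16 * Fintype.card κ + 12) * C₀) * M := by positivity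
  have h35adj := norm_plaqU_adjacent_of_through T U blk hC₀ hU1 h35
  have hV₃ := conj_V₃Op_eq_gradForm T U b g.eta A
  have hV₃' := conj_V₃Op_eq_vThree T U b g.eta A
  have h371 := conj_lapDDLetter_prodCfg (b := b) (T := T) (U := U) hη.ne' A
  have hV0 := hasMajorant_V₃_zero (Rr := Rr) (H := H) b T U blk hη hL A C₀ d₀ δ M₂ α₁ hα₁ hC₀ hδ hM₂ hrepr hlen hsmall hU1
    h337B h337F h337B' hAst hAloc hdAst h35 hd₀B hd₀F hd₀FB hd₀st hd₀loc hd₀0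
  have hV1 := hasMajorant_V₃_one (Rr := Rr) (H := H) b T U blk A d₀ δ M₂ α₁ hα₁ hδ hM₂ hrepr hlen hA hAτB hAτF hU1 hd₀B hd₀F hd₀0
  have hComm := hasMajorant_comm_V₃_one (Rr := Rr) (H := H) b T U blk hη hL A C₀ d₀ δ M₂ α₁ hα₁ hC₀ hδ hM₂ hrepr hT hU1 hA hAτB
    hAτF hAFB h337F h337B h337B' h337Bτ h337FB h35adj hd₀B hd₀F hd₀FB
  have hV0' : HasMajorant (g := toB6 g Rr H) (fun q : (κ × S) × ι => blk q.1.2)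
      (conj b (zeroLetter T U ((g.eta : ℂ)⁻¹) A + F₁Letter T U g.eta A)
        - conj b (dPrimeLetter T (prodCfg U g.eta A) g.eta - dPrimeLetter T U g.eta)
        + conj b (zeroLetter₂ T U ((g.eta : ℂ)⁻¹) A + F₂Letter T U g.eta A))
      (fun a a' => cV385 (Fintype.card κ) α₁ C₀ M * α₁ * (g.len a ^ 2)⁻¹ * Real.exp (-(δ * g.dist a a'))) := by
    refine hasMajorant_mono (g := toB6 g Rr H) _ hV0 fun y y' => ?_
    have h0 : 0 ≤ 28 * (Fintype.card κ : ℝ) * (Fintype.card κ + 1) * M * α₁ * (g.len y ^ 2)⁻¹ * Real.exp (-(δ * g.dist y y')) := by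
      positivity
    have e : cV385 (Fintype.card κ) α₁ C₀ M * α₁ * (g.len y ^ 2)⁻¹ * Real.exp (-(δ * g.dist y y'))
        = cV0 (Fintype.card κ) α₁ C₀ * M₂ * (∑ i, ‖b i‖) * Real.exp (δ * d₀) * α₁ * (g.len y ^ 2)⁻¹ *
            Real.exp (-(δ * g.dist y y'))
          + 28 * (Fintype.card κ : ℝ) * (Fintype.card κ + 1) * M * α₁ * (g.len y ^ 2)⁻¹ * Real.exp (-(δ * g.dist y y')) := by
      rw [hM]; unfold cV385; ring
    rw [e]
    linarith
  have hsum : ∑ _k ∈ (Finset.univ : Finset (κ ⊕ κ)), 14 * ((Fintype.card κ : ℝ) + 1) * M₂ * (∑ i, ‖b i‖) * Real.exp (δ * d₀)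
      ≤ cV385 (Fintype.card κ) α₁ C₀ M := by
    rw [Finset.sum_const, Finset.card_univ, Fintype.card_sum, nsmul_eq_mul, Nat.cast_add]
    have h0 : 0 ≤ cV0 (Fintype.card κ) α₁ C₀ * M := mul_nonneg hcV0 hM0
    have e : cV385 (Fintype.card κ) α₁ C₀ M
        = cV0 (Fintype.card κ) α₁ C₀ * M
          + ((Fintype.card κ : ℝ) + Fintype.card κ) * (14 * ((Fintype.card κ : ℝ) + 1) * M₂ * (∑ i, ‖b i‖) *
            Real.exp (δ * d₀)) := by
      rw [hM]; unfold cV385; ring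
    rw [e]
    linarith
  -- the CommSum level: (3.85) for both composites at the constant `κ′ = κ₃₈₅(c_V + Σ_k c_K)`
  have hSK : 0 ≤ ∑ _k ∈ (Finset.univ : Finset (κ ⊕ κ)), (10 + 8 * Fintype.card κ + (16 * Fintype.card κ + 12) * C₀) * M :=
    Finset.sum_nonneg fun _ _ => hcK0
  have hcVK : 0 ≤ cV385 (Fintype.card κ) α₁ C₀ M
      + ∑ _k ∈ (Finset.univ : Finset (κ ⊕ κ)), (10 + 8 * Fintype.card κ + (16 * Fintype.card κ + 12) * C₀) * M := add_nonneg hcV hSK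
  have hV0'' : HasMajorant (g := toB6 g Rr H) (fun q : (κ × S) × ι => blk q.1.2)
      (conj b (zeroLetter T U ((g.eta : ℂ)⁻¹) A + F₁Letter T U g.eta A)
        - conj b (dPrimeLetter T (prodCfg U g.eta A) g.eta - dPrimeLetter T U g.eta)
        + conj b (zeroLetter₂ T U ((g.eta : ℂ)⁻¹) A + F₂Letter T U g.eta A))
      (fun a a' => (cV385 (Fintype.card κ) α₁ C₀ M
          + ∑ _k ∈ (Finset.univ : Finset (κ ⊕ κ)), (10 + 8 * Fintype.card κ + (16 * Fintype.card κ + 12) * C₀) * M)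
        * α₁ * (g.len a ^ 2)⁻¹ * Real.exp (-(δ * g.dist a a'))) :=
    hasMajorant_mono (g := toB6 g Rr H) _ hV0' fun a a' =>
      mul_le_mul_of_nonneg_right (mul_le_mul_of_nonneg_right (mul_le_mul_of_nonneg_right (le_add_of_nonneg_right hSK) hα₁)
        (inv_nonneg.mpr (sq_nonneg _))) (Real.exp_nonneg _)
  have h385 := ineq385_op_sum (R := Rr) (H := H) (fun q : (κ × S) × ι => blk q.1.2) d Finset.univ δ₀ δ α β ρ Λ B₀
    (cV385 (Fintype.card κ) α₁ C₀ M
      + ∑ _k ∈ (Finset.univ : Finset (κ ⊕ κ)), (10 + 8 * Fintype.card κ + (16 * Fintype.card κ + 12) * C₀) * M)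
    κ₁ κ₂ α₁ (fun _ => 14 * ((Fintype.card κ : ℝ) + 1) * M₂ * (∑ i, ‖b i‖) * Real.exp (δ * d₀))
    hB₀ hcVK hκ₁0 hκ₂ hα₁ hΛ0 hρ hα hβ hδ₀ hr (fun k _ => by positivity) (hsum.trans (le_add_of_nonneg_right hSK)) hdnn htri hlen h261
    hT1 hT2 (V1 := fun k => conj b (V1Letter T U A k) + conj b (V1Letter₂ T U A k))
    (D := fun k => conj b (diffLetter (bT T) (bU U) ((g.eta : ℂ)⁻¹) k)) hV₃ hV0'' (fun k _ => hV1 k) hP₁ hP₂ hG (fun k _ => hDG k)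
  have hGV := hasMajorant_GV_of_gradForm_comm_sum (R := Rr) (H := H) (fun q : (κ × S) × ι => blk q.1.2) d Finset.univ δ₀ δ α β ρ Λ B₀
    (cV385 (Fintype.card κ) α₁ C₀ M) κ₁ κ₂ α₁ (fun _ => 14 * ((Fintype.card κ : ℝ) + 1) * M₂ * (∑ i, ‖b i‖) * Real.exp (δ * d₀))
    (fun _ => (10 + 8 * Fintype.card κ + (16 * Fintype.card κ + 12) * C₀) * M)
    hB₀ hcV hκ₁0 hκ₂ hα₁ hΛ0 hρ hα hβ hδ₀ hr (fun k _ => by positivity) hsum (fun k _ => hcK0) hdnn htri hlen h261 hT1i hT2i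
    (V1 := fun k => conj b (V1Letter T U A k) + conj b (V1Letter₂ T U A k))
    (D := fun k => conj b (diffLetter (bT T) (bU U) ((g.eta : ℂ)⁻¹) k)) hV₃ hV0' (fun k _ => hV1 k)
    (fun k _ => hasMajorant_mono (g := toB6 g Rr H) _ (hComm k) fun y y' => le_of_eq (by rw [hM]; ring))
    hP₁ hP₂ hG (fun k _ => hGD k)
  -- (3.84) for the concrete letters, and the resolvent identities (3.86) of the given inverse
  have h384 := eq384_sub _ _ (conj b (dPrimeLetter T U g.eta)) (conj b (dPrimeLetter T (prodCfg U g.eta A) g.eta)) _ _ _ _ _ _ a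
    _ _ _ _ _ h371 h376 h380 h380s
  rw [← hV₃', ← hP₂def] at h384
  obtain ⟨h386, h386L⟩ := resolvent_of_inverse h384 hΔG hGΔ hinvL hinvR
  -- [4] (2.66): the left and the right entries
  have hρδ : ρ ≤ δ := by linarith only [hr, hαβ]
  have hθ : 0 ≤ kappa385 B₀ (cV385 (Fintype.card κ) α₁ C₀ M
      + ∑ _k ∈ (Finset.univ : Finset (κ ⊕ κ)), (10 + 8 * Fintype.card κ + (16 * Fintype.card κ + 12) * C₀) * M)
      κ₁ κ₂ Λ (B6.c1 d δ₀ β) * α₁ :=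
    mul_nonneg (kappa385_nonneg hB₀ hcVK hκ₁0 hκ₂ hΛ0 (B6RandomWalk.c1_nonneg d δ₀ β)) hα₁
  have hα'ρ : 0 ≤ (1 - α') * ρ := mul_nonneg (sub_nonneg.mpr hα') hρ
  refine ⟨fun X P hP0 hX => ?_, fun Y hY => ?_⟩
  · have hXρ := hasMajorant_rate_mono (R := Rr) (H := H) (fun q : (κ × S) × ι => blk q.1.2) B₀ P hB₀ hP0 hρδ hdnn hX
    exact gExt_leftEntry_of_386 (R := Rr) (H := H) (fun q : (κ × S) × ι => blk q.1.2) d ρ α' _ B₀ P hB₀ hP0 hθ hρ hα' hα'ρ htri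
      hrefl hdnn h261' hsmall385 hXρ h385 h386
  · have hYρ := hasMajorant_rate_mono (R := Rr) (H := H) (fun q : (κ × S) × ι => blk q.1.2) B₀ (fun a => g.len a) hB₀
      (fun a => (hlen a).le) hρδ hdnn hY
    exact gExt_rightEntry_of_386L (R := Rr) (H := H) (fun q : (κ × S) × ι => blk q.1.2) d ρ α' _ B₀ Λρ (fun a => g.len a) hB₀ hΛρ
      (fun a => (hlen a).le) hθ hρ hα' hα'ρ0 hα'ρ2 htri hrefl hsym hdnn h261' hsmall385 hTρ hYρ hGV h386L

end Assembly

end Literature.MathematicalPhysics.QuantumFieldTheory.Balaban1983to89.B9Thm34GEntries342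

end
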